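import Summits.KontsevichZagierPeriods.KontsevichZagierPeriods.Theorems.UnfoldedStokesStokesGenerationFibrewiseRungScaling
import Summits.KontsevichZagierPeriods.KontsevichZagierPeriods.Theorems.UnfoldedStokesStokesGenerationFibrewiseClosureCongr

/-!
# `StokesGeneration` (stmt-KontsevichZagierPeriods-3586) — line `fibrewise_stokes`, stub `stub_landenPartTwo`

Registered stub of rung 18 (LANDEN'S IDENTITY `Li₂(a) + Li₂(−a/(1−a)) + ½ log²(1−a) = 0` for real algebraic
`a < 1`) of the line `fibrewise_stokes` of the crux `StokesGeneration` (route UnfoldedStokes): the two-element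
fibrewise-Stokes certificate (`FibStokesDecomposable 3`, `Theorems/UnfoldedStokesDefs.lean`) on the closed cube
`[0,1]³` (`s = x 0`, `t = x 1`, `u = x 2`) for the `Li₂(−au/(1−au))` part of the homotopy `a ↦ au`.

With `E = 1 − a u + a u s t = 1 − a u (1 − s t)` (positive on the cube, as are `1 − a u`, `1 − a + a s t` and
`1 − a u + a u s`: all are `1 − a p` with `p ∈ [0,1]`, hence `≥ min (1, 1 − a) > 0`) the two elements are
* along `u` (direction `2`): primitive `G₀ = −a u / E`, fibre derivative `D₀ = −a / E²`, faces
  `G₀|_{u=1} − G₀|_{u=0} = −a/(1 − a + a s t) − 0`;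
* along `t` (direction `1`): primitive `G₁ = a t / ((1 − a u) E)`, fibre derivative `D₁ = a / E² = −D₀`,
  faces `G₁|_{t=1} − G₁|_{t=0} = a/((1 − a u)(1 − a u + a u s)) − 0`.
The sum of the two element integrands `D_j − (G_j|_{x_j=1} − G_j|_{x_j=0})` is
`−a/((1 − a u)(1 − a u + a u s)) + a/(1 − a + a s t)`, the displayed function.

Proof: the two elements are built by hand (rational functions of the coordinates with the algebraic constant `a`
are `ℚ`-semialgebraic and continuous on the cube off the zeros of their denominators; the fibre derivatives are
one-variable quotient rules), carried by closed-cube representations (`exists_cubeRep`), assembled by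
`fibStokesDecomposable_of_elements`, and the pointwise identity on the cube is transported by
`fibStokesDecomposable_congr_off_null` with the empty null set — verbatim the pattern of
`fibStokesDecomposable_scalingCore` (rung 11).

References: M. Kontsevich, D. Zagier, *Periods* (2001), §1.2 (rules (2), (3)) and §1.1 (the dilogarithm as a
period); D. Zagier, *The dilogarithm function* (2007), Ch. I §2 (Landen's functional equation
`Li₂(−z/(1−z)) = −Li₂(z) − ½ log²(1−z)`).
-/

noncomputable section

-- `Summit.KontsevichZagierPeriods.KontsevichZagierPeriods.…` is the tree's mandated layout (single-conjunct summit).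
set_option linter.dupNamespace false

namespace Summit.KontsevichZagierPeriods.KontsevichZagierPeriods.Cruxes.StokesGeneration.FibrewiseStokes

open MeasureTheory Set
open Literature.NumberTheory.Transcendental
open Literature.NumberTheory.Transcendental.KZ
open Literature.ModelTheory.ExponentialFields (IsSemialgebraic)

/-- For `a < 1` and `p ∈ [0,1]` the affine form `1 − a p` is positive (it is `≥ 1` if `a ≤ 0` and `≥ 1 − a`
if `0 ≤ a`): the common lower bound of all denominators of the Landen certificates. [folklore] -/
private theorem landenTwo_one_sub_mul_pos {a p : ℝ} (ha1 : a < 1) (hp0 : 0 ≤ p) (hp1 : p ≤ 1) :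
    0 < 1 - a * p := by
  rcases le_or_gt 0 a with ha | ha
  · have : a * p ≤ a := mul_le_of_le_one_right ha hp1
    linarith
  · have : 0 ≤ -a * p := mul_nonneg (by linarith) hp0
    linarith

/-- **Registered stub `stub_landenPartTwo` (rung 18, Landen's identity): the two-element certificate of the
`Li₂(−au/(1−au))` part of the homotopy `a ↦ au`.** For real algebraic `a < 1`, on the closed cube `[0,1]³`
(`s = x 0`, `t = x 1`, `u = x 2`) the function `−a/((1 − a u)(1 − a u + a u s)) + a/(1 − a + a s t)` is
fibrewise-Stokes decomposable: it is the sum of the two element integrands of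
`G₀ = −a u/(1 − a u + a u s t)` along `u` and `G₁ = a t/((1 − a u)(1 − a u + a u s t))` along `t`
(`∂_u G₀ = −a/(1 − a u + a u s t)² = −∂_t G₁`; faces `−a/(1 − a + a s t) − 0` and
`a/((1 − a u)(1 − a u + a u s)) − 0`). [folklore] -/
theorem stub_landenPartTwo (a : ℝ) (ha : IsAlgebraic ℚ a) (ha1 : a < 1) :
    FibStokesDecomposable 3 (fun x => -(a / ((1 - a * x 2) * (1 - a * x 2 + a * x 2 * x 0))) +
      a / (1 - a + a * x 0 * x 1)) := by
  set C : Set (Fin 3 → ℝ) := Set.pi Set.univ (fun _ : Fin 3 => Set.Icc (0:ℝ) 1) with hC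
  have hCsa : IsSemialgebraic ℚ C := by rw [hC, ← cube_eq_pi]; exact isSemialgebraic_cube
  have hCc : IsCompact C := isCompact_univ_pi fun _ => isCompact_Icc
  have hmem : ∀ x ∈ C, ∀ i, x i ∈ Set.Icc (0:ℝ) 1 := fun x hx i => (Set.mem_univ_pi.mp hx) i
  have hupd : ∀ x ∈ C, ∀ (i : Fin 3), ∀ s ∈ Set.Icc (0:ℝ) 1, Function.update x i s ∈ C :=
    fun x hx i s hs => update_mem_cubePi hx i hs
  have h02 : (0 : Fin 3) ≠ 2 := by decide
  have h12 : (1 : Fin 3) ≠ 2 := by decide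
  have h01 : (0 : Fin 3) ≠ 1 := by decide
  have h21 : (2 : Fin 3) ≠ 1 := by decide
  have h0I : (0:ℝ) ∈ Set.Icc (0:ℝ) 1 := ⟨le_rfl, zero_le_one⟩
  have h1I : (1:ℝ) ∈ Set.Icc (0:ℝ) 1 := ⟨zero_le_one, le_rfl⟩
  -- positivity of the denominators `1 − a u` and `E = 1 − a u + a u s t = 1 − a u (1 − s t)` on the cube
  have hmulI : ∀ u ∈ Set.Icc (0:ℝ) 1, ∀ v ∈ Set.Icc (0:ℝ) 1, u * v ∈ Set.Icc (0:ℝ) 1 :=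
    fun u hu v hv => ⟨mul_nonneg hu.1 hv.1, by nlinarith [hu.1, hu.2, hv.1, hv.2]⟩
  have hFne : ∀ x ∈ C, 1 - a * x 2 ≠ 0 := fun x hx =>
    (landenTwo_one_sub_mul_pos ha1 (hmem x hx 2).1 (hmem x hx 2).2).ne'
  have hEne : ∀ x ∈ C, 1 - a * x 2 + a * x 2 * x 0 * x 1 ≠ 0 := by
    intro x hx
    have hst := hmulI _ (hmem x hx 0) _ (hmem x hx 1)
    have hp := hmulI _ (hmem x hx 2) (1 - x 0 * x 1) ⟨by linarith [hst.2], by linarith [hst.1]⟩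
    have := landenTwo_one_sub_mul_pos ha1 hp.1 hp.2
    exact ne_of_gt (by linarith)
  have hE2ne : ∀ x ∈ C, (1 - a * x 2 + a * x 2 * x 0 * x 1) ^ 2 ≠ 0 := fun x hx => pow_ne_zero 2 (hEne x hx)
  have hFEne : ∀ x ∈ C, (1 - a * x 2) * (1 - a * x 2 + a * x 2 * x 0 * x 1) ≠ 0 := fun x hx =>
    mul_ne_zero (hFne x hx) (hEne x hx)
  -- semialgebraic atoms on `C`
  have hx0 : IsSemialgebraicFunOn ℚ C (fun x => x 0) := isSemialgebraicFunOn_apply hCsa 0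
  have hx1 : IsSemialgebraicFunOn ℚ C (fun x => x 1) := isSemialgebraicFunOn_apply hCsa 1
  have hx2 : IsSemialgebraicFunOn ℚ C (fun x => x 2) := isSemialgebraicFunOn_apply hCsa 2
  have hca : IsSemialgebraicFunOn ℚ C (fun _ => a) := isSemialgebraicFunOn_const_of_isAlgebraic hCsa ha
  have hc1 : IsSemialgebraicFunOn ℚ C (fun _ => (1:ℝ)) :=
    isSemialgebraicFunOn_const_of_isAlgebraic hCsa isAlgebraic_one
  have hFsa : IsSemialgebraicFunOn ℚ C (fun x => 1 - a * x 2) := hc1.fun_sub (hca.fun_mul hx2)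
  have hEsa : IsSemialgebraicFunOn ℚ C (fun x => 1 - a * x 2 + a * x 2 * x 0 * x 1) :=
    hFsa.fun_add (((hca.fun_mul hx2).fun_mul hx0).fun_mul hx1)
  have hE2sa : IsSemialgebraicFunOn ℚ C (fun x => (1 - a * x 2 + a * x 2 * x 0 * x 1) ^ 2) := hEsa.fun_pow 2
  -- continuity of the denominators
  have hFc : Continuous fun x : Fin 3 → ℝ => 1 - a * x 2 := by fun_prop
  have hEc : Continuous fun x : Fin 3 → ℝ => 1 - a * x 2 + a * x 2 * x 0 * x 1 := by fun_prop
  -- the witnesses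
  obtain ⟨G0, hG0⟩ : ∃ G0 : (Fin 3 → ℝ) → ℝ,
      G0 = fun x => -(a * x 2) / (1 - a * x 2 + a * x 2 * x 0 * x 1) := ⟨_, rfl⟩
  obtain ⟨D0, hD0⟩ : ∃ D0 : (Fin 3 → ℝ) → ℝ,
      D0 = fun x => -(a / (1 - a * x 2 + a * x 2 * x 0 * x 1) ^ 2) := ⟨_, rfl⟩
  obtain ⟨G1, hG1⟩ : ∃ G1 : (Fin 3 → ℝ) → ℝ,
      G1 = fun x => a * x 1 / ((1 - a * x 2) * (1 - a * x 2 + a * x 2 * x 0 * x 1)) := ⟨_, rfl⟩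
  obtain ⟨D1, hD1⟩ : ∃ D1 : (Fin 3 → ℝ) → ℝ,
      D1 = fun x => a / (1 - a * x 2 + a * x 2 * x 0 * x 1) ^ 2 := ⟨_, rfl⟩
  have hG0sa : IsSemialgebraicFunOn ℚ C G0 := by rw [hG0]; exact (hca.fun_mul hx2).fun_neg.div hEsa hEne
  have hD0sa : IsSemialgebraicFunOn ℚ C D0 := by rw [hD0]; exact (hca.div hE2sa hE2ne).fun_neg
  have hG1sa : IsSemialgebraicFunOn ℚ C G1 := by
    rw [hG1]; exact (hca.fun_mul hx1).div (hFsa.fun_mul hEsa) hFEne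
  have hD1sa : IsSemialgebraicFunOn ℚ C D1 := by rw [hD1]; exact hca.div hE2sa hE2ne
  have hG0c : ContinuousOn G0 C := by
    rw [hG0]
    exact (by fun_prop : Continuous fun x : Fin 3 → ℝ => -(a * x 2)).continuousOn.div hEc.continuousOn hEne
  have hD0c : ContinuousOn D0 C := by
    rw [hD0]; exact (continuous_const.continuousOn.div (hEc.continuousOn.pow 2) hE2ne).neg
  have hG1c : ContinuousOn G1 C := by
    rw [hG1]
    exact (by fun_prop : Continuous fun x : Fin 3 → ℝ => a * x 1).continuousOn.div (hFc.mul hEc).continuousOn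
      hFEne
  have hD1c : ContinuousOn D1 C := by
    rw [hD1]; exact continuous_const.continuousOn.div (hEc.continuousOn.pow 2) hE2ne
  -- composition with the (semialgebraic, continuous) face maps `x ↦ x[i ↦ t]`, `t ∈ {0, 1}`
  have hface_sa : ∀ {F : (Fin 3 → ℝ) → ℝ}, IsSemialgebraicFunOn ℚ C F → ∀ (i : Fin 3) (t : ℝ),
      IsAlgebraic ℚ t → t ∈ Set.Icc (0:ℝ) 1 →
        IsSemialgebraicFunOn ℚ C (fun x => F (Function.update x i t)) :=
    fun hF i t ht htI => IsSemialgebraicFunOn.comp_isSemialgebraicMapOn_holds hF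
      (isSemialgebraicMapOn_update_const i ht) fun x hx => hupd x hx i t htI
  have hface_c : ∀ {F : (Fin 3 → ℝ) → ℝ}, ContinuousOn F C → ∀ (i : Fin 3) (t : ℝ),
      t ∈ Set.Icc (0:ℝ) 1 → ContinuousOn (fun x => F (Function.update x i t)) C :=
    fun hF i t htI => hF.comp (continuous_id.update i continuous_const).continuousOn fun x hx => hupd x hx i t htI
  have hcu : ∀ (x : Fin 3 → ℝ) (i : Fin 3), Continuous fun s : ℝ => Function.update x i s :=
    fun x i => continuous_const.update i continuous_id
  -- the two integrands and their representations on the cube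
  obtain ⟨I0, hI0⟩ : ∃ I0 : (Fin 3 → ℝ) → ℝ, I0 = fun x =>
      D0 x - (G0 (Function.update x 2 1) - G0 (Function.update x 2 0)) := ⟨_, rfl⟩
  obtain ⟨I1, hI1⟩ : ∃ I1 : (Fin 3 → ℝ) → ℝ, I1 = fun x =>
      D1 x - (G1 (Function.update x 1 1) - G1 (Function.update x 1 0)) := ⟨_, rfl⟩
  have hI0sa : IsSemialgebraicFunOn ℚ C I0 := by
    rw [hI0]
    exact hD0sa.fun_sub ((hface_sa hG0sa 2 1 isAlgebraic_one h1I).fun_sub (hface_sa hG0sa 2 0 isAlgebraic_zero h0I))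
  have hI1sa : IsSemialgebraicFunOn ℚ C I1 := by
    rw [hI1]
    exact hD1sa.fun_sub ((hface_sa hG1sa 1 1 isAlgebraic_one h1I).fun_sub (hface_sa hG1sa 1 0 isAlgebraic_zero h0I))
  have hI0c : ContinuousOn I0 C := by
    rw [hI0]; exact hD0c.sub ((hface_c hG0c 2 1 h1I).sub (hface_c hG0c 2 0 h0I))
  have hI1c : ContinuousOn I1 C := by
    rw [hI1]; exact hD1c.sub ((hface_c hG1c 1 1 h1I).sub (hface_c hG1c 1 0 h0I))
  obtain ⟨q0, hq0d, hq0i⟩ := exists_cubeRep 3 I0 hI0sa hI0c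
  obtain ⟨q1, hq1d, hq1i⟩ := exists_cubeRep 3 I1 hI1sa hI1c
  -- bounds
  have hbound : ∀ {F : (Fin 3 → ℝ) → ℝ}, ContinuousOn F C → ∃ B : ℝ, ∀ x ∈ C, |F x| ≤ B := by
    intro F hF
    obtain ⟨B, hB⟩ := hCc.exists_bound_of_continuousOn hF
    exact ⟨B, fun x hx => by simpa [Real.norm_eq_abs] using hB x hx⟩
  -- assemble the two elements
  have hdec : FibStokesDecomposable 3 (fun x => ∑ j, ((![q0, q1] : Fin 2 → IntegralRep 3) j).integrand x) := by
    refine fibStokesDecomposable_of_elements (M := 3) (J := 2) (![2, 1] : Fin 2 → Fin 3)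
      (![G0, G1] : Fin 2 → (Fin 3 → ℝ) → ℝ) (![D0, D1] : Fin 2 → (Fin 3 → ℝ) → ℝ)
      (![q0, q1] : Fin 2 → IntegralRep 3) ?_ ?_
    · refine Fin.forall_fin_two.mpr ⟨?_, ?_⟩
      · -- element 0, along `u = x 2`
        simp only [Matrix.cons_val_zero]
        refine ⟨hG0sa, hD0sa, hbound hG0c, fun x hx => ?_, fun x hx _ => ?_⟩
        · -- fibre continuity
          show ContinuousOn (fun s : ℝ => G0 (Function.update x 2 s)) (Set.Icc (0:ℝ) 1)
          exact hG0c.comp (hcu x 2).continuousOn fun s hs => hupd x hx 2 s hs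
        · -- fibre derivative: quotient rule for `s ↦ −a s / (1 − a s + a s x₀ x₁)`
          show HasDerivAt (fun s : ℝ => G0 (Function.update x 2 s)) (D0 x) (x 2)
          have hfun : (fun s : ℝ => G0 (Function.update x 2 s)) =
              fun s => -(a * s) / (1 - a * s + a * s * x 0 * x 1) := by
            funext s; rw [hG0]
            simp only [Function.update_self, Function.update_of_ne h02, Function.update_of_ne h12]
          rw [hfun, hD0]
          simp only
          have hN : HasDerivAt (fun s : ℝ => -(a * s)) (-(a * 1)) (x 2) :=
            ((hasDerivAt_id' (x 2)).const_mul a).neg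
          have hE : HasDerivAt (fun s : ℝ => 1 - a * s + a * s * x 0 * x 1) (-(a * 1) + a * 1 * x 0 * x 1) (x 2) :=
            (((hasDerivAt_id' (x 2)).const_mul a).const_sub 1).add
              ((((hasDerivAt_id' (x 2)).const_mul a).mul_const (x 0)).mul_const (x 1))
          refine (hN.div hE (hEne x hx)).congr_deriv ?_
          ring
      · -- element 1, along `t = x 1`
        simp only [Matrix.cons_val_one, Matrix.cons_val_zero]
        refine ⟨hG1sa, hD1sa, hbound hG1c, fun x hx => ?_, fun x hx _ => ?_⟩
        · show ContinuousOn (fun s : ℝ => G1 (Function.update x 1 s)) (Set.Icc (0:ℝ) 1)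
          exact hG1c.comp (hcu x 1).continuousOn fun s hs => hupd x hx 1 s hs
        · -- fibre derivative: quotient rule for `s ↦ a s / ((1 − a x₂)(1 − a x₂ + a x₂ x₀ s))`
          show HasDerivAt (fun s : ℝ => G1 (Function.update x 1 s)) (D1 x) (x 1)
          have hfun : (fun s : ℝ => G1 (Function.update x 1 s)) =
              fun s => a * s / ((1 - a * x 2) * (1 - a * x 2 + a * x 2 * x 0 * s)) := by
            funext s; rw [hG1]
            simp only [Function.update_self, Function.update_of_ne h01, Function.update_of_ne h21]
          rw [hfun, hD1]
          simp only
          have hN : HasDerivAt (fun s : ℝ => a * s) (a * 1) (x 1) := (hasDerivAt_id' (x 1)).const_mul a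
          have hQ : HasDerivAt (fun s : ℝ => (1 - a * x 2) * (1 - a * x 2 + a * x 2 * x 0 * s))
              ((1 - a * x 2) * (a * x 2 * x 0 * 1)) (x 1) :=
            (((hasDerivAt_id' (x 1)).const_mul (a * x 2 * x 0)).const_add (1 - a * x 2)).const_mul (1 - a * x 2)
          refine (hN.div hQ (hFEne x hx)).congr_deriv ?_
          have hF' := hFne x hx
          have hE' := hEne x hx
          field_simp
          ring
    · refine Fin.forall_fin_two.mpr ⟨?_, ?_⟩
      · simp only [Matrix.cons_val_zero]
        exact ⟨hq0d, fun x _ => by rw [hq0i, hI0]⟩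
      · simp only [Matrix.cons_val_one, Matrix.cons_val_zero]
        exact ⟨hq1d, fun x _ => by rw [hq1i, hI1]⟩
  -- the pointwise identity on the cube (faces `G₀|_{u=0} = 0 = G₁|_{t=0}`, `D₀ + D₁ = 0`)
  refine fibStokesDecomposable_congr_off_null 3 _ _ ∅
    Literature.ModelTheory.ExponentialFields.isSemialgebraic_empty measure_empty (fun x _ _ => ?_) hdec
  simp only [Fin.sum_univ_two, Matrix.cons_val_zero, Matrix.cons_val_one, hq0i, hq1i, hI0, hI1, hG0, hG1, hD0,
    hD1, Function.update_self, Function.update_of_ne h02, Function.update_of_ne h12, Function.update_of_ne h01,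
    Function.update_of_ne h21, mul_one, mul_zero, neg_zero, zero_div, sub_zero]
  ring

end Summit.KontsevichZagierPeriods.KontsevichZagierPeriods.Cruxes.StokesGeneration.FibrewiseStokes

end
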